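import Literature.MathematicalPhysics.StatisticalMechanics.Theil2006DefectiveBondCount
import Literature.MathematicalPhysics.StatisticalMechanics.Theil2006SeparatedCounting
import Literature.MathematicalPhysics.StatisticalMechanics.Theil2006DistanceSet
import Mathlib.Analysis.Convex.Topology
import HarnessLib

/-!
# Theil 2006, Appendix pp. 24–25 — Proposition 2.9 (26), (27) from the pointwise inputs of their
printed proof ((69)–(72)) — proofs; and `𝒯_λ(y)` as finsets

Topic `Literature/MathematicalPhysics/StatisticalMechanics`; companion of `Theil2006.lean`
(F. Theil, *A proof of crystallization in two dimensions*, Comm. Math. Phys. **262** (2006)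
209–236, read in the accepted preprint of 26 Aug 2005, lit store `paper:url-69bff4ce1e30`),
Appendix, *Proof of Proposition 2.9*, preprint p. 24. Everything here is PROVED (D-0026: no named
fact); the two local inputs of the printed proof that come from Proposition 4.8 (reference
configurations) are explicit hypotheses.

## Source, as printed (preprint p. 24)

"*Proof of Proposition 2.9.* We first establish estimate (26). Let for each `x ∈ X` and `λ ∈ Λ`
`s(x, λ) = #{T ∈ 𝒯_λ | x ∈ T}` be the number of simplices with side length `λ` which have `x` as
a corner. We start with the identity (69) `Σ_{x∈X} s(x, λ) = 3#𝒯_λ`, which expresses the trivial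
fact that the sum the of number of books read by each member of a group can also be computed by
adding the number of readers of each book. We will demonstrate that for each `x ∈ X`
(70) `s(x, λ) ≤ m(λ) s(x, 1)`. [… via Proposition 4.8: `s(x,1) = 6`, `s(x, λ) ≤ 6m(λ)` …]
For the other direction we apply again Proposition 2.8.2 and deduce that for each `x ∈ X` with
the property that `s(x, λ) < 6m(λ)` there exists `x_b ∈ ∂X` such that `y(x_b) ∈ B(y(x), 28λ)`.
Since the minimum distance between particles is bounded from below by `½` (Lemma 2.2) we have the
bound (71) `#y⁻¹(B(y(x_b), 28λ)) ≤ Cλ²`. By (18) and (70) we obtain that the number of simplices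
in `𝒯_λ` which have at least one corner lying in `B(y(x_b), 28λ)` is bounded by `Cλ²m(λ)`."
((26): `0 ≤ #𝒯₁ − (1/m(λ)) #𝒯_λ(y) ≤ Cλ² #∂X`, p. 9.)

## What is here

* `Theil2006.IsCentredSimplex` — the tree's Definition 2.6 `IsEquilateralSimplex` plus, for
  `λ > 1`, the centring clause "vertices within `λ` of the barycentre" that closes a loophole of
  the printed definition (see its docstring); `Theil2006.simplicesAt α y λ` — `𝒯_λ(y)` as a
  finset of centred simplices; `longSimplices`
  (`⋃_{λ∈Λ∖{1}} 𝒯_λ(y)`), `sideOf` (the side parameter of a long simplex, junk `0` otherwise);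
  `cornerCount α y λ x = s(x, λ)`.
* `sum_cornerCount` — (69), PROVED (double counting).
* `cornerCount_one_le_six` — `s(x,1) ≤ 6` under (13), PROVED from (18) (`≤ 6` neighbours) and
  "a short bond lies in at most two unit simplices" (`simplexCount_le_two`), by double counting
  `2 s(x,1) = Σ_{x' ∈ 𝒩(x)∖{x}} #{T ∈ 𝒯₁ | {x,x'} ⊂ T}`.
* `card_near_defects_le` — (71) summed over the defects: the particles within `28λ` of a defect
  number at most `4(56λ+1)² #∂X` (from `card_filter_dist_le_le`).
* `prop29_first_of_pointwise` — **(26) from (70) and the near-defect alternative**, PROVED with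
  `C = 8·57² = 25992`: if `s(x,λ) ≤ m(λ)s(x,1)` for all `x` and every `x` with `s(x,λ) < 6m(λ)`
  has a defect `x_b` with `|y(x) − y(x_b)| ≤ 28λ`, then
  `0 ≤ #𝒯₁ − #𝒯_λ/m(λ) ≤ 25992 λ² #∂X`.

* `prop29_second_of_pointwise` — **(27) from (72) and the partition identity of p. 25**, PROVED
  with `C = 311904` (near unit simplices have area `≤ 4`, `volume_convexHull_unitSimplex_le`, and
  are `≤ 24(56λ+1)² #∂X` many, `card_unitSimplices_near_defects_le`).

* `h34_of_rigidity_of_multiplicity` — **(34) from its two printed steps**: the per-simplex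
  rigidity estimate (Proposition 4.3 (52) on the patch `ω_T`) and the multiplicity bound (28),
  PROVED by double counting (`C₃₄ = C₅₂ C₂₈`).

Not here: (70), the near-defect alternative, (72), the partition identity, (52) per simplex and
(28) themselves (Propositions 4.8 / 4.3 of the appendix, pp. 18–25).
-/

noncomputable section

namespace Literature.MathematicalPhysics.StatisticalMechanics

namespace Theil2006

open MeasureTheory Metric

variable {α : ℝ} {N : ℕ} {y : Fin N → Plane}

/-! ### `𝒯_λ(y)` as finsets -/

/-- **Definition 2.6 with its loophole closed: centred equilateral simplices.** The tree's
`IsEquilateralSimplex α y λ T` (Definition 2.6 as printed, reading (a) of (24)) together with, for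
`λ > 1`, "every vertex of `T` lies within `λ` of the barycentre `z = ⅓Σ_{x∈T} y(x)`" (the bound
the paper itself records for the simplices it constructs: "Estimate (61) implies that
`|⅓Σ_{x∈T±} y(x) − y(x₁)| ≤ λ`", Appendix p. 24), so that `T ⊂ y⁻¹(B̄(z,3λ)) ⊂ ω_T` sits well
inside the rigid part of the patch. For an honest equilateral simplex (side `≈ λ`) the vertices
are at distance `≈ λ/√3` from `z`, so nothing intended is lost; without the clause Definition 2.6
admits "simplices" whose three particles lie in the annulus `B(z,5λ)∖B(z,3λ)`, have no short
bonds inside `ω_T`, and are given an arbitrary small lattice triangle by `Φ_T` — for those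
Lemma 2.7 (25) fails (LIT1 §32, flag F3). For `λ = 1` the clause is vacuous
(`isCentredSimplex_one_iff`).
[cite: Theil2006, §2.3 Definition 2.6 with Lemma 2.7 (preprint p. 8); clause ours] -/
def IsCentredSimplex (α : ℝ) (y : Fin N → Plane) (lam : ℝ) (T : Finset (Fin N)) : Prop :=
  IsEquilateralSimplex α y lam T ∧ (1 < lam → ∀ x ∈ T, dist (y x) (simplexCentre y T) ≤ lam)

/-- At `λ = 1` centred = equilateral. [cite: Theil2006, §2.3 Definition 2.6 (preprint p. 8)] -/
theorem isCentredSimplex_one_iff {T : Finset (Fin N)} :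
    IsCentredSimplex α y 1 T ↔ IsEquilateralSimplex α y 1 T :=
  ⟨fun h => h.1, fun h => ⟨h, fun h1 => absurd h1 (lt_irrefl _)⟩⟩

open scoped Classical in
/-- **`𝒯_λ(y)`** as a finset: the centred equilateral simplices of side `λ` (Definition 2.6 with
the centring clause of `IsCentredSimplex`). [cite: Theil2006, §2.3 Definition 2.6 (preprint p. 8)] -/
def simplicesAt (α : ℝ) (y : Fin N → Plane) (lam : ℝ) : Finset (Finset (Fin N)) :=
  Finset.univ.filter fun T => IsCentredSimplex α y lam T

open scoped Classical in
/-- **The long simplices `⋃_{λ ∈ Λ∖{1}} 𝒯_λ(y)`** (centred).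
[cite: Theil2006, §2.3 Proposition 2.8 (preprint p. 8)] -/
def longSimplices (α : ℝ) (y : Fin N → Plane) : Finset (Finset (Fin N)) :=
  Finset.univ.filter fun T => ∃ lam ∈ distSet \ {1}, IsCentredSimplex α y lam T

open scoped Classical in
/-- **The side parameter `λ(T)` of a long simplex** (well defined by Proposition 2.8 (1):
"there exists a unique number `λ ∈ Λ` such that `𝒯(x₁,x₂) ⊂ 𝒯_λ(y)`"); junk `0` otherwise.
[cite: Theil2006, §2.3 Proposition 2.8 (1) (preprint p. 8)] -/
def sideOf (α : ℝ) (y : Fin N → Plane) (T : Finset (Fin N)) : ℝ :=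
  if h : ∃ lam ∈ distSet \ {1}, IsCentredSimplex α y lam T then Classical.choose h else 0

/-- Membership in `𝒯_λ(y)`. [cite: Theil2006, §2.3 Definition 2.6 (preprint p. 8)] -/
theorem mem_simplicesAt {lam : ℝ} {T : Finset (Fin N)} :
    T ∈ simplicesAt α y lam ↔ IsCentredSimplex α y lam T := by
  classical
  simp [simplicesAt]

/-- Membership in the long simplices. [cite: Theil2006, §2.3 Proposition 2.8 (preprint p. 8)] -/
theorem mem_longSimplices {T : Finset (Fin N)} :
    T ∈ longSimplices α y ↔ ∃ lam ∈ distSet \ {1}, IsCentredSimplex α y lam T := by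
  classical
  simp [longSimplices]

/-- The side parameter of a long simplex is one of its sides' parameters. [cite: Theil2006, §2.3 Proposition 2.8 (1) (preprint p. 8); our lemma] -/
theorem sideOf_spec {T : Finset (Fin N)}
    (h : ∃ lam ∈ distSet \ {1}, IsCentredSimplex α y lam T) :
    sideOf α y T ∈ distSet \ {1} ∧ IsCentredSimplex α y (sideOf α y T) T := by
  classical
  rw [sideOf, dif_pos h]
  exact Classical.choose_spec h

/-- `𝒯₁(y)` is `𝒯_λ(y)` at `λ = 1`. [cite: Theil2006, §2.3 Definition 2.6 (preprint p. 8)] -/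
theorem unitSimplices_eq_simplicesAt : unitSimplices α y = simplicesAt α y 1 := by
  ext T
  rw [mem_unitSimplices_iff, mem_simplicesAt, isCentredSimplex_one_iff]

/-! ### `s(x, λ)` and (69) -/

open scoped Classical in
/-- **`s(x, λ) = #{T ∈ 𝒯_λ | x ∈ T}`**, the number of simplices of side `λ` with corner `x`.
[cite: Theil2006, Appendix, proof of Proposition 2.9 (preprint p. 24)] -/
def cornerCount (α : ℝ) (y : Fin N → Plane) (lam : ℝ) (x : Fin N) : ℕ :=
  ((simplicesAt α y lam).filter fun T => x ∈ T).card

/-- **(69)** `Σ_{x∈X} s(x, λ) = 3 #𝒯_λ` ("the number of books read by each member of a group can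
also be computed by adding the number of readers of each book").
[cite: Theil2006, Appendix, proof of Proposition 2.9 (69) (preprint p. 24)] -/
theorem sum_cornerCount (lam : ℝ) :
    ∑ x, cornerCount α y lam x = 3 * (simplicesAt α y lam).card := by
  classical
  unfold cornerCount
  have h : ∑ x : Fin N, ((simplicesAt α y lam).filter fun T => x ∈ T).card =
      ∑ T ∈ simplicesAt α y lam, T.card := by
    simp_rw [Finset.card_filter]
    rw [Finset.sum_comm]
    refine Finset.sum_congr rfl fun T _ => ?_
    rw [Finset.card_eq_sum_ones T, Finset.sum_ite_mem, Finset.univ_inter]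
  rw [h, Finset.sum_const_nat fun T hT => (mem_simplicesAt.1 hT).1.card_eq_three, mul_comm]

/-- **`s(x, 1) ≤ 6`** under (13) (`0 < α ≤ 1/50`): by double counting,
`2 s(x,1) = Σ_{x'∈𝒩(x)∖{x}} #{T ∈ 𝒯₁ | {x,x'} ⊂ T} ≤ 6 · 2`.
[cite: Theil2006, §2.2 (18) and Appendix p. 24 ("s(x,1) = 6"); our bound] -/
theorem cornerCount_one_le_six (hα : 0 < α) (hα' : α ≤ 1 / 50)
    (hsep : ∀ i j : Fin N, i ≠ j → 1 - α < dist (y i) (y j)) (x : Fin N) :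
    cornerCount α y 1 x ≤ 6 := by
  classical
  have hα1 : α < 1 := by linarith
  unfold cornerCount
  set A := (simplicesAt α y 1).filter fun T => x ∈ T with hA
  -- every `T ∈ A` is `{x} ∪ (two neighbours of x)`
  have hAmem : ∀ T ∈ A, IsEquilateralSimplex α y 1 T ∧ x ∈ T := fun T hT => by
    have h := Finset.mem_filter.1 hT
    exact ⟨(mem_simplicesAt.1 h.1).1, h.2⟩
  have hl : ∑ T ∈ A, (T.erase x).card = 2 * A.card := by
    rw [mul_comm, Finset.sum_const_nat (m := 2) fun T hT => ?_]
    obtain ⟨hT, hxT⟩ := hAmem T hT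
    rw [Finset.card_erase_of_mem hxT, hT.card_eq_three]
  have hshort : ∀ T ∈ A, ∀ a ∈ T.erase x, a ∈ neighbours α y x := by
    intro T hTA a haT
    rw [mem_neighbours_iff]
    obtain ⟨hT1, hxT⟩ := hAmem T hTA
    have hax := Finset.mem_erase.1 haT
    exact (isEquilateralSimplex_one_iff.1 hT1).2 x hxT a hax.2 (Ne.symm hax.1)
  have h2 : 2 * A.card = ∑ a : Fin N, (A.filter fun T => a ∈ T.erase x).card := by
    rw [← hl]
    have e1 : ∀ T : Finset (Fin N),
        (T.erase x).card = ∑ a : Fin N, if a ∈ T.erase x then 1 else 0 := by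
      intro T
      rw [Finset.sum_ite_mem, Finset.univ_inter, Finset.card_eq_sum_ones]
    simp_rw [Finset.card_filter, e1]
    exact Finset.sum_comm
  have h3 : ∀ a, (A.filter fun T => a ∈ T.erase x).card ≤
      if a ∈ neighbours α y x then 2 else 0 := by
    intro a
    split_ifs with ha
    · have hsc : (A.filter fun T => a ∈ T.erase x).card ≤ simplexCount α y x a := by
        unfold simplexCount
        refine Finset.card_le_card fun T hT => ?_
        rw [Finset.mem_filter] at hT ⊢
        obtain ⟨hTA, haT⟩ := hT
        exact ⟨unitSimplices_eq_simplicesAt (α := α) (y := y) ▸ (Finset.mem_filter.1 hTA).1,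
          (hAmem T hTA).2, (Finset.mem_erase.1 haT).2⟩
      exact hsc.trans (simplexCount_le_two hα (by linarith) hsep ((mem_neighbours_iff).1 ha))
    · rw [Nat.le_zero, Finset.card_eq_zero, Finset.filter_eq_empty_iff]
      exact fun T hTA haT => ha (hshort T hTA a haT)
  have h4 : ∑ a : Fin N, (A.filter fun T => a ∈ T.erase x).card ≤ (neighbours α y x).card * 2 := by
    refine (Finset.sum_le_sum fun a _ => h3 a).trans ?_
    rw [Finset.sum_ite_mem, Finset.univ_inter, Finset.sum_const, smul_eq_mul]
  have h6 := card_neighbours_le_six hα hα' hsep x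
  have : 2 * A.card ≤ 6 * 2 := by
    rw [h2]; exact h4.trans (Nat.mul_le_mul_right 2 h6)
  omega

/-! ### (71) summed over the defects, and (26) -/

/-- **(71), summed**: under (13) (`0 < α ≤ ½`) the particles within `28λ` of some defect number
at most `4(56λ+1)² #∂X`. [cite: Theil2006, Appendix, proof of Proposition 2.9 (71) (preprint p. 24); constants ours] -/
theorem card_near_defects_le (hα : 0 < α) (hα' : α ≤ 1 / 2)
    (hsep : ∀ i j : Fin N, i ≠ j → 1 - α < dist (y i) (y j)) {R : ℝ} (hR : 0 ≤ R) :
    (((Finset.univ.filter fun x : Fin N =>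
        ∃ b ∈ defects α y, dist (y x) (y b) ≤ R).card : ℕ) : ℝ) ≤
      4 * (2 * R + 1) ^ 2 * (defects α y).card := by
  classical
  have hsub : (Finset.univ.filter fun x : Fin N => ∃ b ∈ defects α y, dist (y x) (y b) ≤ R) ⊆
      (defects α y).biUnion fun b => Finset.univ.filter fun x : Fin N => dist (y x) (y b) ≤ R := by
    intro x hx
    rw [Finset.mem_biUnion]
    obtain ⟨b, hb, hxb⟩ := (Finset.mem_filter.1 hx).2
    exact ⟨b, hb, Finset.mem_filter.2 ⟨Finset.mem_univ _, hxb⟩⟩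
  calc (((Finset.univ.filter fun x : Fin N => ∃ b ∈ defects α y, dist (y x) (y b) ≤ R).card : ℕ) : ℝ)
      ≤ (((defects α y).biUnion fun b =>
          Finset.univ.filter fun x : Fin N => dist (y x) (y b) ≤ R).card : ℝ) := by
        exact_mod_cast Finset.card_le_card hsub
    _ ≤ ∑ b ∈ defects α y, (((Finset.univ.filter fun x : Fin N => dist (y x) (y b) ≤ R).card : ℕ) : ℝ) := by
        exact_mod_cast Finset.card_biUnion_le
    _ ≤ ∑ b ∈ defects α y, 4 * (2 * R + 1) ^ 2 :=
        Finset.sum_le_sum fun b _ => card_filter_dist_le_le hα hα' hsep (y b) hR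
    _ = 4 * (2 * R + 1) ^ 2 * (defects α y).card := by
        rw [Finset.sum_const, nsmul_eq_mul, mul_comm]

/-- **Theil 2006, Proposition 2.9 (26) from the pointwise counts of its printed proof.** Under (13)
(`0 < α ≤ 1/50`), for `λ ≥ 1` with `m(λ) ≠ 0`: IF (70) `s(x, λ) ≤ m(λ) s(x, 1)` for every `x`, and
every `x` with `s(x, λ) < 6 m(λ)` has a defect `x_b` with `|y(x) − y(x_b)| ≤ 28λ` (the printed
"other direction", from Proposition 2.8.2), THEN
(26) `0 ≤ #𝒯₁ − (1/m(λ)) #𝒯_λ(y) ≤ C λ² #∂X` with `C = 25992`.  Proof as printed: (69) twice,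
(70) pointwise for the lower bound; for the upper bound the summands `m(λ)s(x,1) − s(x,λ)` vanish
unless `x` is within `28λ` of a defect (`s(x,1) ≤ 6`), are `≤ 6m(λ)` each, and (71).
[cite: Theil2006, §2.3 Proposition 2.9 (26) with Appendix proof (69)–(71) (preprint pp. 9, 24)] -/
theorem prop29_first_of_pointwise (hα : 0 < α) (hα' : α ≤ 1 / 50)
    (hsep : ∀ i j : Fin N, i ≠ j → 1 - α < dist (y i) (y j)) {lam : ℝ} (hlam : 1 ≤ lam)
    (hm : m lam ≠ 0)
    (h70 : ∀ x : Fin N, cornerCount α y lam x ≤ m lam * cornerCount α y 1 x)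
    (hnear : ∀ x : Fin N, cornerCount α y lam x < 6 * m lam →
      ∃ b ∈ defects α y, dist (y x) (y b) ≤ 28 * lam) :
    0 ≤ ((unitSimplices α y).card : ℝ) - 1 / (m lam : ℝ) * (simplicesAt α y lam).card ∧
      ((unitSimplices α y).card : ℝ) - 1 / (m lam : ℝ) * (simplicesAt α y lam).card ≤
        25992 * lam ^ 2 * (defects α y).card := by
  classical
  have hm0 : (0 : ℝ) < m lam := by exact_mod_cast Nat.pos_of_ne_zero hm
  -- (69) twice, in `ℝ`
  have h69 : ((∑ x, cornerCount α y lam x : ℕ) : ℝ) = 3 * (simplicesAt α y lam).card := by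
    rw [sum_cornerCount]; push_cast; ring
  have h69' : ((∑ x, cornerCount α y 1 x : ℕ) : ℝ) = 3 * (unitSimplices α y).card := by
    rw [sum_cornerCount, unitSimplices_eq_simplicesAt]; push_cast; ring
  -- lower bound from (70)
  have hlow : ((simplicesAt α y lam).card : ℝ) ≤ m lam * (unitSimplices α y).card := by
    have h : ∑ x, cornerCount α y lam x ≤ ∑ x, m lam * cornerCount α y 1 x :=
      Finset.sum_le_sum fun x _ => h70 x
    rw [← Finset.mul_sum] at h
    have h' : ((∑ x, cornerCount α y lam x : ℕ) : ℝ) ≤ ((m lam * ∑ x, cornerCount α y 1 x : ℕ) : ℝ) := by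
      exact_mod_cast h
    rw [Nat.cast_mul, h69, h69'] at h'
    linarith
  -- upper bound
  set Near := Finset.univ.filter fun x : Fin N => ∃ b ∈ defects α y, dist (y x) (y b) ≤ 28 * lam
    with hNear
  have hpt : ∀ x : Fin N, (m lam : ℝ) * cornerCount α y 1 x - cornerCount α y lam x ≤
      if x ∈ Near then 6 * (m lam : ℝ) else 0 := by
    intro x
    have h6 : (cornerCount α y 1 x : ℝ) ≤ 6 := by exact_mod_cast cornerCount_one_le_six hα hα' hsep x
    split_ifs with hx
    · have h0 : (0 : ℝ) ≤ cornerCount α y lam x := Nat.cast_nonneg _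
      nlinarith
    · have hge : 6 * m lam ≤ cornerCount α y lam x := by
        by_contra hlt
        exact hx (Finset.mem_filter.2 ⟨Finset.mem_univ _, hnear x (not_le.1 hlt)⟩)
      have hge' : (6 : ℝ) * m lam ≤ cornerCount α y lam x := by exact_mod_cast hge
      nlinarith
  have hsum : (m lam : ℝ) * (3 * (unitSimplices α y).card) - 3 * (simplicesAt α y lam).card ≤
      6 * (m lam : ℝ) * Near.card := by
    have h := Finset.sum_le_sum fun x (_ : x ∈ (Finset.univ : Finset (Fin N))) => hpt x
    rw [Finset.sum_sub_distrib, ← Finset.mul_sum, Finset.sum_ite_mem, Finset.univ_inter,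
      Finset.sum_const, nsmul_eq_mul] at h
    have e1 : ((∑ x, cornerCount α y 1 x : ℕ) : ℝ) = ∑ x, (cornerCount α y 1 x : ℝ) := by push_cast; rfl
    have e2 : ((∑ x, cornerCount α y lam x : ℕ) : ℝ) = ∑ x, (cornerCount α y lam x : ℝ) := by
      push_cast; rfl
    rw [← e1, ← e2, h69, h69'] at h
    linarith
  have hNearle : (Near.card : ℝ) ≤ 4 * (2 * (28 * lam) + 1) ^ 2 * (defects α y).card :=
    card_near_defects_le hα (by linarith) hsep (by positivity)
  have hB : (0 : ℝ) ≤ (defects α y).card := Nat.cast_nonneg _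
  refine ⟨?_, ?_⟩
  · -- 0 ≤ #𝒯₁ − #𝒯_λ/m
    have : 1 / (m lam : ℝ) * (simplicesAt α y lam).card ≤ (unitSimplices α y).card := by
      rw [one_div, inv_mul_le_iff₀ hm0]; linarith
    linarith
  · -- ≤ 8 (56λ+1)² #∂X ≤ 25992 λ² #∂X
    have hkey : (m lam : ℝ) * (((unitSimplices α y).card : ℝ) -
        1 / (m lam : ℝ) * (simplicesAt α y lam).card) ≤
        (m lam : ℝ) * (8 * (2 * (28 * lam) + 1) ^ 2 * (defects α y).card) := by
      have e : (m lam : ℝ) * (((unitSimplices α y).card : ℝ) -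
          1 / (m lam : ℝ) * (simplicesAt α y lam).card) =
          (m lam : ℝ) * (unitSimplices α y).card - (simplicesAt α y lam).card := by
        field_simp
      rw [e]
      nlinarith [hm0.le]
    have h1 := le_of_mul_le_mul_left hkey hm0
    have h2 : 8 * (2 * (28 * lam) + 1) ^ 2 ≤ 25992 * lam ^ 2 := by nlinarith
    nlinarith


/-! ### (27) from (72) and the partition identity -/

/-- **A unit simplex has area at most `4`**: `conv y(S) ⊂ B̄(y(a), 1+α)` for a corner `a`, so
`meas(conv y(S)) ≤ π(1+α)² ≤ 4` (`α ≤ 1/50`). [folklore] -/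
private theorem volume_convexHull_unitSimplex_le (hα0 : 0 ≤ α) (hα' : α ≤ 1 / 50) {S : Finset (Fin N)}
    (hS : S ∈ unitSimplices α y) : (volume (convexHull ℝ (y '' ↑S))).toReal ≤ 4 := by
  classical
  have hS1 := (isEquilateralSimplex_one_iff.1 (mem_unitSimplices_iff.1 hS))
  obtain ⟨a, ha⟩ : S.Nonempty := by
    rw [← Finset.card_pos, hS1.1]; norm_num
  have hsub : convexHull ℝ (y '' ↑S) ⊆ Metric.closedBall (y a) (1 + α) := by
    refine convexHull_min ?_ (convex_closedBall _ _)
    rintro _ ⟨x, hx, rfl⟩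
    rw [Metric.mem_closedBall]
    by_cases hxa : x = a
    · subst hxa; simp; linarith
    · exact (hS1.2 x hx a ha hxa).dist_le
  have hvol : volume (convexHull ℝ (y '' ↑S)) ≤ ENNReal.ofReal ((1 + α) ^ 2 * Real.pi) := by
    rw [← volume_closedBall_plane (y a) (by linarith)]
    exact MeasureTheory.measure_mono hsub
  have hfin : ENNReal.ofReal ((1 + α) ^ 2 * Real.pi) ≠ ⊤ := ENNReal.ofReal_ne_top
  refine (ENNReal.toReal_mono hfin hvol).trans ?_
  rw [ENNReal.toReal_ofReal (by positivity)]
  nlinarith [Real.pi_lt_d2, Real.pi_pos]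

/-- **The unit simplices with a corner within `R` of a defect are few**: at most
`24(2R+1)² #∂X` of them ((71) summed, times `s(x,1) ≤ 6`).
[cite: Theil2006, Appendix, proof of Proposition 2.9 (71), (18) (preprint pp. 24–25); constants ours] -/
theorem card_unitSimplices_near_defects_le (hα : 0 < α) (hα' : α ≤ 1 / 50)
    (hsep : ∀ i j : Fin N, i ≠ j → 1 - α < dist (y i) (y j)) {R : ℝ} (hR : 0 ≤ R) :
    ((((unitSimplices α y).filter fun S =>
        ∃ x ∈ S, ∃ b ∈ defects α y, dist (y x) (y b) ≤ R).card : ℕ) : ℝ) ≤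
      24 * (2 * R + 1) ^ 2 * (defects α y).card := by
  classical
  set Near := Finset.univ.filter fun x : Fin N => ∃ b ∈ defects α y, dist (y x) (y b) ≤ R
    with hNear
  have hsub : ((unitSimplices α y).filter fun S =>
      ∃ x ∈ S, ∃ b ∈ defects α y, dist (y x) (y b) ≤ R) ⊆
      Near.biUnion fun x => (simplicesAt α y 1).filter fun T => x ∈ T := by
    intro S hS
    rw [Finset.mem_biUnion]
    obtain ⟨hS1, x, hxS, hxb⟩ := Finset.mem_filter.1 hS
    exact ⟨x, Finset.mem_filter.2 ⟨Finset.mem_univ _, hxb⟩,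
      Finset.mem_filter.2 ⟨unitSimplices_eq_simplicesAt (α := α) (y := y) ▸ hS1, hxS⟩⟩
  have h1 : (((unitSimplices α y).filter fun S =>
      ∃ x ∈ S, ∃ b ∈ defects α y, dist (y x) (y b) ≤ R).card : ℕ) ≤ Near.card * 6 := by
    refine (Finset.card_le_card hsub).trans (Finset.card_biUnion_le.trans ?_)
    have h := Finset.sum_le_card_nsmul Near (cornerCount α y 1) 6
      fun x _ => cornerCount_one_le_six hα hα' hsep x
    rw [smul_eq_mul] at h
    exact h
  have h2 : (Near.card : ℝ) ≤ 4 * (2 * R + 1) ^ 2 * (defects α y).card :=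
    card_near_defects_le hα (by linarith) hsep hR
  have h1' : ((((unitSimplices α y).filter fun S =>
      ∃ x ∈ S, ∃ b ∈ defects α y, dist (y x) (y b) ≤ R).card : ℕ) : ℝ) ≤ (Near.card : ℝ) * 6 := by
    exact_mod_cast h1
  nlinarith [h1', h2, sq_nonneg (2 * R + 1)]

/-- **Theil 2006, Proposition 2.9 (27) from the pointwise inputs of its printed proof.** Under (13)
(`0 < α ≤ 1/50`), for `λ ≥ 1` with `m(λ) ≠ 0`, writing `meas` for the Lebesgue measure of
`conv y(·)`: IF (partition, "`=^{Lemma 2.7}`" on p. 25) for every `T ∈ 𝒯_λ(y)`,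
`meas(T) = Σ_{S∈𝒯₁} meas(conv y(S) ∩ conv y(T))`; (72) for every `S ∈ 𝒯₁`,
`Σ_{T∈𝒯_λ} meas(conv y(S) ∩ conv y(T)) ≤ m(λ)λ² meas(S)` ("`n(S, λ) ≤ m(λ)λ²`"); and equality
— as the lower bound `m(λ)λ² meas(S) ≤ Σ_T meas(conv y(S) ∩ conv y(T))` — for every `S` all of
whose corners are farther than `28λ` from every defect; THEN
(27) `0 ≤ Σ_{S∈𝒯₁} meas(S) − (1/(λ²m(λ))) Σ_{T∈𝒯_λ} meas(T) ≤ C λ² #∂X` with `C = 311904`.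
Proof as printed (p. 25): exchange the sums; the deficit is at most `Σ_{S near ∂X} meas(S)`, and
the unit simplices near the defects are `≤ Cλ² #∂X` many ((71), (18)), each of area `≤ 4`.
[cite: Theil2006, §2.3 Proposition 2.9 (27) with Appendix proof (72) (preprint pp. 9, 24–25)] -/
theorem prop29_second_of_pointwise (hα : 0 < α) (hα' : α ≤ 1 / 50)
    (hsep : ∀ i j : Fin N, i ≠ j → 1 - α < dist (y i) (y j)) {lam : ℝ} (hlam : 1 ≤ lam)
    (hm : m lam ≠ 0)
    (hpart : ∀ T ∈ simplicesAt α y lam, (volume (convexHull ℝ (y '' ↑T))).toReal =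
      ∑ S ∈ unitSimplices α y, (volume (convexHull ℝ (y '' ↑S) ∩ convexHull ℝ (y '' ↑T))).toReal)
    (h72 : ∀ S ∈ unitSimplices α y,
      ∑ T ∈ simplicesAt α y lam, (volume (convexHull ℝ (y '' ↑S) ∩ convexHull ℝ (y '' ↑T))).toReal ≤
        m lam * lam ^ 2 * (volume (convexHull ℝ (y '' ↑S))).toReal)
    (h72eq : ∀ S ∈ unitSimplices α y, (∀ x ∈ S, ∀ b ∈ defects α y, 28 * lam < dist (y x) (y b)) →
      m lam * lam ^ 2 * (volume (convexHull ℝ (y '' ↑S))).toReal ≤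
        ∑ T ∈ simplicesAt α y lam,
          (volume (convexHull ℝ (y '' ↑S) ∩ convexHull ℝ (y '' ↑T))).toReal) :
    0 ≤ ∑ S ∈ unitSimplices α y, (volume (convexHull ℝ (y '' ↑S))).toReal -
        1 / (lam ^ 2 * m lam) * ∑ T ∈ simplicesAt α y lam, (volume (convexHull ℝ (y '' ↑T))).toReal ∧
      ∑ S ∈ unitSimplices α y, (volume (convexHull ℝ (y '' ↑S))).toReal -
        1 / (lam ^ 2 * m lam) * ∑ T ∈ simplicesAt α y lam, (volume (convexHull ℝ (y '' ↑T))).toReal ≤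
        311904 * lam ^ 2 * (defects α y).card := by
  classical
  have hm0 : (0 : ℝ) < m lam := by exact_mod_cast Nat.pos_of_ne_zero hm
  have hμ : (0 : ℝ) < lam ^ 2 * m lam := by positivity
  -- abbreviations
  set T1 := unitSimplices α y with hT1
  set TL := simplicesAt α y lam with hTLdef
  set A : Finset (Fin N) → ℝ := fun S => (volume (convexHull ℝ (y '' ↑S))).toReal with hAdef
  set I : Finset (Fin N) → ℝ := fun S =>
    ∑ T ∈ TL, (volume (convexHull ℝ (y '' ↑S) ∩ convexHull ℝ (y '' ↑T))).toReal with hIdef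
  -- exchange of sums: Σ_T meas(T) = Σ_S I(S)
  have hex : ∑ T ∈ TL, A T = ∑ S ∈ T1, I S := by
    rw [Finset.sum_congr rfl fun T hT => hpart T hT, Finset.sum_comm]
  have hA0 : ∀ S, 0 ≤ A S := fun S => ENNReal.toReal_nonneg
  have hI0 : ∀ S, 0 ≤ I S := fun S => Finset.sum_nonneg fun T _ => ENNReal.toReal_nonneg
  -- upper: Σ_S I(S) ≤ m λ² Σ_S A(S)
  have hup : ∑ S ∈ T1, I S ≤ m lam * lam ^ 2 * ∑ S ∈ T1, A S := by
    rw [Finset.mul_sum]; exact Finset.sum_le_sum fun S hS => h72 S hS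
  -- the near simplices
  set NearS := T1.filter fun S => ∃ x ∈ S, ∃ b ∈ defects α y, dist (y x) (y b) ≤ 28 * lam
    with hNearS
  have hlowS : ∀ S ∈ T1, m lam * lam ^ 2 * (A S - if S ∈ NearS then A S else 0) ≤ I S := by
    intro S hS
    split_ifs with hn
    · simp only [sub_self, mul_zero]; exact hI0 S
    · rw [sub_zero]
      refine h72eq S hS fun x hx b hb => ?_
      by_contra hle
      exact hn (Finset.mem_filter.2 ⟨hS, x, hx, b, hb, not_lt.1 hle⟩)
  have hlow : m lam * lam ^ 2 * (∑ S ∈ T1, A S - ∑ S ∈ NearS, A S) ≤ ∑ S ∈ T1, I S := by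
    have h := Finset.sum_le_sum hlowS
    rw [← Finset.mul_sum, Finset.sum_sub_distrib, Finset.sum_ite_mem,
      Finset.inter_eq_right.2 (Finset.filter_subset _ _)] at h
    exact h
  -- the near simplices have small total area
  have hnearA : ∑ S ∈ NearS, A S ≤ 4 * (24 * (2 * (28 * lam) + 1) ^ 2 * (defects α y).card) := by
    have h1 : ∑ S ∈ NearS, A S ≤ ∑ S ∈ NearS, (4 : ℝ) :=
      Finset.sum_le_sum fun S hS =>
        volume_convexHull_unitSimplex_le hα.le hα' (Finset.mem_filter.1 hS).1
    rw [Finset.sum_const, nsmul_eq_mul] at h1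
    have h2 : ((NearS.card : ℕ) : ℝ) ≤ 24 * (2 * (28 * lam) + 1) ^ 2 * (defects α y).card :=
      card_unitSimplices_near_defects_le hα hα' hsep (by positivity)
    nlinarith
  refine ⟨?_, ?_⟩
  · -- 0 ≤ Σ A − (1/(λ²m)) Σ_T A
    have : 1 / (lam ^ 2 * m lam) * ∑ T ∈ TL, A T ≤ ∑ S ∈ T1, A S := by
      rw [hex, one_div, inv_mul_le_iff₀ hμ]; nlinarith
    linarith
  · have hkey : ∑ S ∈ T1, A S - 1 / (lam ^ 2 * m lam) * ∑ T ∈ TL, A T ≤ ∑ S ∈ NearS, A S := by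
      rw [hex]
      have : ∑ S ∈ T1, A S - ∑ S ∈ NearS, A S ≤ 1 / (lam ^ 2 * m lam) * ∑ S ∈ T1, I S := by
        rw [one_div, le_inv_mul_iff₀ hμ]; nlinarith
      linarith
    have hB : (0 : ℝ) ≤ (defects α y).card := Nat.cast_nonneg _
    have h3 : 4 * (24 * (2 * (28 * lam) + 1) ^ 2) ≤ 311904 * lam ^ 2 := by nlinarith
    nlinarith


/-! ### (34) from the per-simplex rigidity estimate and the multiplicity bound (28) -/

/-- **Theil 2006, (34) from its two printed steps.** For `λ ≥ 1` and a choice of patches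
`ω_T ⊂ X` (`T ∈ 𝒯_λ(y)`): IF (first step, Proposition 4.3 (52) applied on `ω_T`) for every
`T ∈ 𝒯_λ(y)`, `Σ_{{x,x'}⊂T} (|y(x)−y(x')| − λ)² ≤ C₅₂ log(λ) Σ_{{x,x'}∈𝒮, {x,x'}⊂ω_T} (|y(x)−y(x')| − 1)²`,
and (second step, (28)) every particle lies in at most `C₂₈ λ² m(λ)` of the patches `ω_T`, THEN
(34) `λ⁻⁷ Σ_{T∈𝒯_λ} Σ_{{x,x'}⊂T} (|y(x)−y(x')| − λ)² ≤ C₅₂C₂₈ λ⁻⁵ log(λ) m(λ) Σ_{𝒮} (|y(x)−y(x')| − 1)²`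
(double counting: `Σ_T Σ_{p⊂ω_T} f(p) ≤ max_p #{T | p ⊂ ω_T} · Σ_p f(p)`).
[cite: Theil2006, §2.4 (34) with (28) and Appendix Proposition 4.3 (52) (preprint pp. 9–11, 18)] -/
theorem h34_of_rigidity_of_multiplicity {lam C₅₂ C₂₈ : ℝ} (hlam : 1 ≤ lam) (hC₅₂ : 0 ≤ C₅₂)
    (ω : Finset (Fin N) → Finset (Fin N))
    (h52 : ∀ T ∈ simplicesAt α y lam,
      1 / 2 * ∑ p ∈ T.offDiag, (dist (y p.1) (y p.2) - lam) ^ 2 ≤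
        C₅₂ * Real.log lam * ∑ p ∈ (shortRangePairs α y).filter (fun p => p.1 ∈ ω T ∧ p.2 ∈ ω T),
          (dist (y p.1) (y p.2) - 1) ^ 2)
    (h28 : ∀ x : Fin N, (((simplicesAt α y lam).filter fun T => x ∈ ω T).card : ℝ) ≤
      C₂₈ * lam ^ 2 * m lam) :
    lam⁻¹ ^ 7 * ∑ T ∈ simplicesAt α y lam,
        (1 / 2 * ∑ p ∈ T.offDiag, (dist (y p.1) (y p.2) - lam) ^ 2) ≤
      C₅₂ * C₂₈ * lam⁻¹ ^ 5 * Real.log lam * m lam *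
        ∑ p ∈ shortRangePairs α y, (dist (y p.1) (y p.2) - 1) ^ 2 := by
  classical
  set TL := simplicesAt α y lam with hTL
  set f : Fin N × Fin N → ℝ := fun p => (dist (y p.1) (y p.2) - 1) ^ 2 with hf
  have hf0 : ∀ p, 0 ≤ f p := fun p => sq_nonneg _
  have hlog : 0 ≤ Real.log lam := Real.log_nonneg hlam
  have hl0 : 0 < lam := by linarith
  -- first step summed over T
  have h1 : ∑ T ∈ TL, (1 / 2 * ∑ p ∈ T.offDiag, (dist (y p.1) (y p.2) - lam) ^ 2) ≤
      C₅₂ * Real.log lam * ∑ T ∈ TL,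
        ∑ p ∈ (shortRangePairs α y).filter (fun p => p.1 ∈ ω T ∧ p.2 ∈ ω T), f p := by
    rw [Finset.mul_sum]
    exact Finset.sum_le_sum fun T hT => h52 T hT
  -- double counting
  have h2 : ∑ T ∈ TL, ∑ p ∈ (shortRangePairs α y).filter (fun p => p.1 ∈ ω T ∧ p.2 ∈ ω T), f p =
      ∑ p ∈ shortRangePairs α y, ((TL.filter fun T => p.1 ∈ ω T ∧ p.2 ∈ ω T).card : ℝ) * f p := by
    simp_rw [Finset.sum_filter]
    rw [Finset.sum_comm]
    refine Finset.sum_congr rfl fun p _ => ?_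
    rw [← Finset.sum_filter, Finset.sum_const, nsmul_eq_mul]
  have h3 : ∀ p ∈ shortRangePairs α y,
      ((TL.filter fun T => p.1 ∈ ω T ∧ p.2 ∈ ω T).card : ℝ) * f p ≤ C₂₈ * lam ^ 2 * m lam * f p := by
    intro p _
    refine mul_le_mul_of_nonneg_right ?_ (hf0 p)
    refine le_trans ?_ (h28 p.1)
    exact_mod_cast Finset.card_le_card fun T hT => by
      rw [Finset.mem_filter] at hT ⊢
      exact ⟨hT.1, hT.2.1⟩
  have h4 : ∑ T ∈ TL, ∑ p ∈ (shortRangePairs α y).filter (fun p => p.1 ∈ ω T ∧ p.2 ∈ ω T), f p ≤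
      C₂₈ * lam ^ 2 * m lam * ∑ p ∈ shortRangePairs α y, f p := by
    rw [h2, Finset.mul_sum]
    exact Finset.sum_le_sum h3
  have hQ : 0 ≤ ∑ p ∈ shortRangePairs α y, f p := Finset.sum_nonneg fun p _ => hf0 p
  have h5 : ∑ T ∈ TL, (1 / 2 * ∑ p ∈ T.offDiag, (dist (y p.1) (y p.2) - lam) ^ 2) ≤
      C₅₂ * Real.log lam * (C₂₈ * lam ^ 2 * m lam * ∑ p ∈ shortRangePairs α y, f p) :=
    h1.trans (mul_le_mul_of_nonneg_left h4 (mul_nonneg hC₅₂ hlog))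
  have hl7 : 0 ≤ lam⁻¹ ^ 7 := by positivity
  calc lam⁻¹ ^ 7 * ∑ T ∈ TL, (1 / 2 * ∑ p ∈ T.offDiag, (dist (y p.1) (y p.2) - lam) ^ 2)
      ≤ lam⁻¹ ^ 7 * (C₅₂ * Real.log lam *
          (C₂₈ * lam ^ 2 * m lam * ∑ p ∈ shortRangePairs α y, f p)) :=
        mul_le_mul_of_nonneg_left h5 hl7
    _ = C₅₂ * C₂₈ * lam⁻¹ ^ 5 * Real.log lam * m lam * ∑ p ∈ shortRangePairs α y, f p := by
        field_simp

end Theil2006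

end Literature.MathematicalPhysics.StatisticalMechanics
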